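import Summits.QuantumFields.YangMills.Theorems.BalabanUVNodesN05AtXPinnedHSViewSepCoPHOfLeaf
import Summits.QuantumFields.YangMills.Theorems.BalabanUVNodesN05SubBHKnitUnivOfThm33P6Beta

/-!
# BalabanUVNodes ∕ N05 ([B8], `Dag.B8_main`) AT THE K1 ENGINE'S X-PINNED VIEW (v1.7 key `SepCoPH`) — THE JUNCTION-APPLIED `Ω₀ = ℤᵈ` ROAD WITH PROPOSITION 6 KNIT IN,
# READ AT THE RECORD: N05 in ∃-currency at the S-BOUND FOUR-PIN X-H record `Node00.IsRecordOfRecord₁₃CSepCoPHSX3HV` (+ the same-datum `₁₃CSepCoPH` companion) and at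
# dag-n10-d's generic S-class `Node00.IsRecordOfRecord₁₃CSepCoPHS`, with the [B8] residual layer's constants AND Proposition 6's `c₁` PRODUCED, fed by
# `BalabanUVNodesN05SubBHKnitUnivOfThm33P6Beta` (N06's Theorem 3.3 BY NAME + dag-n06-b's dictionaries at the law and cube members + [4] Thm 3.1-type letters + Prop. 5's
# plain sockets at the cube members + N05's printed Prop. 7 displayed — NO `p6`), through the GENERIC leaf-to-record face `BalabanUVNodesN05AtXPinnedHSViewSepCoPHOfLeaf`

Track A of `YM-PLAN.md` (cell `pub-ymgap`, HUMAN RULING D-0062), node **N05** = [Balaban1985RegularSpaces] Lemma 1, Thm 2, Prop 3, Thm 4, Props 5–7, Thm 8; seat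
`pub-ymgap-dag-n05-d` (g9), 2026-08-27; strategy s2.  Inputs BY NAME: `BalabanUVNodesN05SubBHKnitUnivOfThm33P6Beta.exists_b8LeafOfRecordSubBH_cutSubB_zdLan_of_thm33_lettersRDU_univ_lin_p6β`
(this seat g9: the junction applied on the guarded-additivity letters, Proposition 6 supplied by dag-n05-e's uniform β letter p563537, `c₁` produced),
`BalabanUVNodesN05AtXPinnedHSViewSepCoPHOfLeaf` (this seat g8, p554516: `exists_isRecordOfRecord₁₃CSepCoPHSX3HV_b8_of_leaf`, `exists_isRecordOfRecord₁₃CSepCoPHS_b8_of_leaf` — ANY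
layer carrying the repaired slot ⇒ the records).  The sibling `BalabanUVNodesN05AtXPinnedHSViewSepCoPHOfThm33` (p555933) is the same reading of the total-additivity knit with
`p6` displayed; THIS file reads the guarded-additivity knit with `p6` knit in.

WHAT IS PROVED (composition BY NAME; no estimate; no new definition):
* ★ **`exists_isRecordOfRecord₁₃CSepCoPHSX3HV_b8_of_thm33_lettersRDU_univ_lin_p6β`** — admissible `θ : Stage13HParams F N` with v1.7 provisos `h`, ANY consumer layer
  `lam₀ : ResidB8 θ.toStage3Params` and the inputs of `…KnitUnivOfThm33P6Beta` AT `θ.toStage3Params` ([4] Thm 3.1-type letters `SLet ∕ SLetUB` at the `Ω₀ = ℤᵈ` law members and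
  `SLetL ∕ SLetLU` at the Prop.-5 members `ι`; `h33 : B9.Thm33Printed c35 geo bg Gp GA`; dag-n06-b's member-local dictionaries `DictAt ∕ Prop6At ∕ InvAt ∕ CurvAt ∕ LandauAt ∕
  AvgAt ∕ HolderAt ∕ LinBddAt ∕ SrcAt ∕ SrcHolderAt` at the law members and `DictAt ∕ Prop6At ∕ InvAt ∕ CurvAt ∕ LandauAt ∕ AvgAtβ` at the cube members of (1.131); Proposition
  5's three plain sockets at the cube members for every `B₀ˢ ≥ 1` (`hSP5C`); a consumer threshold `B₁⁰`; N05's printed `p7`) ⇒ for every `γw ∈ ]0, θ.γ]` THERE EXIST [B9]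
  inputs and constants `inp C₂ B₁′ B₁ B₂ B₀β c₁` (`0 < c₁`, `B₁ ≥ B₁⁰`) and worlds `w w′` — `IsRecordOfRecord₁₃CSepCoPHSX3HV F N (datumOfRecord₁₃SepCoPH θ h) w`, EVERY run's
  `b8` leaf and `Dag.B8_main`, the same-datum `₁₃CSepCoPH` companion `w′` — the binding displayed at
  `(θ.pinX3H ({lam₀ with inp, C₂, B₁′, B₁, B₂, B₀β}.cutSubB J (zdLan θ.L B₁ ∘ ι) c₁) lam12 lam13).view₁₃CoPHB10YZW Mstar opsY ζ lamW`.
  The SAME world `w` is also recorded in dag-n10-d's generic S-class `IsRecordOfRecord₁₃CSepCoPHS` (the tree twin of the K1 skeleton's `RecordS`; one-term slice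
  `isRecordOfRecord₁₃CSepCoPHS_of_isRecordOfRecord₁₃CSepCoPHSX3HV`) — one extra conjunct instead of a twin theorem (file budget).
A6 (director-ym №189 (3)): as in `…KnitUnivOfThm33P6Beta` — law-member binders inhabited at every truncation-0 member by dag-n06-b's `binders_inhabited_univ_zero_lin`
(p554374), cube-member β binders at truncation 0 by dag-n06-b's `B9SupplySockB9P3ZdBeta.Witness.binders_inhabited_cube_zero` (p541339); `m ≥ 1` A6-UNCHECKED; the letters
`SLet…` and the cube-member Prop.-5 sockets `hSP5C` have no in-tree provider ∕ witness (`SockP5u` at a cube member: none; print's Prop. 6 needs no uniqueness); `p7`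
junk-inhabitable as typed; A2: inhabitation of `(θ, h)` = K0⁷ (open).
HONEST FRAMING: kernel bookkeeping by name; all sockets ∕ dictionary binders ∕ letters are HYPOTHESES; `Prop6At ∕ p7` are HYPOTHESES = N05's own printed members NOT
discharged; count-neutral; **N05 NOT discharged**; K1 NOT claimed; Bałaban AS PRINTED with locators; one finite 𝕋⁴ programme at fixed ε; nothing continuum ∕ ℝ⁴ ∕ OS ∕
mass-gap ∕ Clay.  No `sorry`, no new definition.
[cite: Balaban1985RegularSpaces, Lemma 1 p.79, Thm 2 p.83, Prop. 3 p.87, Thm 4 p.88, Prop. 5 (1.106)–(1.110) p.94, Thm 8 (1.146) p.101, Prop. 6 (1.131)–(1.138) pp.98–99 (supplied modulo the displayed hypotheses), Prop. 7 p.100 (named hypothesis); Balaban1985BackgroundPropagators, Thm 3.3 p.399 (by name), Thm 3.1 p.397, (3.16) p.393 (hypotheses); Balaban1989LargeFieldII, Thm 1 + (0.1) pp.355–356 (the record, bookkeeping)]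
-/

noncomputable section

namespace Summit.QuantumFields.YangMills.BalabanUVNodes.N05AtXPinnedHSViewSepCoPHOfThm33P6Beta


open Literature.MathematicalPhysics.QuantumFieldTheory.Balaban1983to89
open Literature.MathematicalPhysics.QuantumFieldTheory.Balaban1983to89.Node00
open Literature.MathematicalPhysics.QuantumFieldTheory.Balaban1983to89.T4Continuum
open Literature.MathematicalPhysics.QuantumFieldTheory.Balaban1983to89.DagBinding
open Literature.MathematicalPhysics.QuantumFieldTheory.Balaban1983to89.B8IdxB8LawsB (towerBonds IdxB8LawsB IdxB8SubB famB8OfRecordSubB)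
open Literature.MathematicalPhysics.QuantumFieldTheory.Balaban1983to89.B8LeafModelZd (ZdIdx SockP5base SockP5 SockP5u)
open Literature.MathematicalPhysics.QuantumFieldTheory.Balaban1983to89.B8LeafModelZd3 (SockB9P3)
open Literature.MathematicalPhysics.QuantumFieldTheory.Balaban1983to89.B8SockLettersRD (SockLettersRD)
open Literature.MathematicalPhysics.QuantumFieldTheory.Balaban1983to89.B8Lemma1NonAbelian (mulCfg blockPairNA)
open Literature.MathematicalPhysics.QuantumFieldTheory.Balaban1983to89.B8Eq131CubesAdmissible (cubeFam)
open Literature.MathematicalPhysics.QuantumFieldTheory.Balaban1983to89.B8CubeMemberZd (cubeLamS cubeLamB)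
open Literature.MathematicalPhysics.QuantumFieldTheory.Balaban1983to89.B8Prop5LandauDataZd (ZdLanIdx zdLan)
open Literature.MathematicalPhysics.QuantumFieldTheory.Balaban1983to89.B9SupplySockB9P3ZdLetters (OpsZd)
open Literature.MathematicalPhysics.QuantumFieldTheory.Balaban1983to89.B9SupplySockB9P3ZdAt (DictAt Prop6At InvAt CurvAt LandauAt AvgAt HolderAt SrcAt SrcHolderAt)
open Literature.MathematicalPhysics.QuantumFieldTheory.Balaban1983to89.B9SupplySockB9P3ZdAtLin (LinBddAt)
open Literature.MathematicalPhysics.QuantumFieldTheory.Balaban1983to89.B9SupplySockB9P3ZdBeta (AvgAtβ)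
open Summit.QuantumFields.YangMills.BalabanUVNodes.N05SubBHKnitUnivOfThm33P6Beta (exists_b8LeafOfRecordSubBH_cutSubB_zdLan_of_thm33_lettersRDU_univ_lin_p6β)
open Summit.QuantumFields.YangMills.BalabanUVNodes.N05AtXPinnedHSViewSepCoPHOfLeaf (exists_isRecordOfRecord₁₃CSepCoPHSX3HV_b8_of_leaf)
open MatrixLog B7Prop1Explicit B7Prop2Explicit B7Prop1Local B7Eq92Concrete
open B8Ineq130 (tlo thi)
open B8Ineq132 (InAk covDerivFwd)
open B7Eq78Linearization (zdBlocking QprimeIter)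
open B8Eq119TwistedAxial (bgT Restr129 InAx)
open B8Eq140Level (SideTouches)
open B8Eq138LandauZd (covLap QT InR138 IsLandau146W)
open B8Eq1117Concrete (XSpace)
open B8Prop5ContractionKLevel (Bd2)
open B8LambdaSpaceKLevel (wt)
open B8Eq184Proof (gaugeExp cfgExp)
open B8Eq146AExpansion (iEta)
open B7Prop4GeneralLevels (linCovIter)
open B8Eq155JBound (Jcur wsup)
open B8ScaledSupNorm (bondNorm msup Bdd)
open B9Eq340HolderZd (hquot AdmPair)

-- `Site` alone could resolve to the torus sites of `Setup.lean`; re-export the `ℤ^d` sites of `B7Prop1Explicit`.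
export B7Prop1Explicit (Site)

variable {F : T4Family} {N : ℕ} [NeZero N]

section Record

/-- ★ **N05 IN ∃-CURRENCY AT THE STAGE-13 RECORD OF RECORD, FROM N06's THEOREM 3.3 BY NAME WITH PROPOSITION 6 KNIT IN** (four-pin S-bound X-H v1.7 record + same-datum
`₁₃CSepCoPH` companion).  ADMISSIBLE Stage-13 parameters `θ` WITH v1.7 PROVISOS `h`, ANY consumer layer `lam₀` and the inputs of
`BalabanUVNodesN05SubBHKnitUnivOfThm33P6Beta.exists_b8LeafOfRecordSubBH_cutSubB_zdLan_of_thm33_lettersRDU_univ_lin_p6β` AT `θ.toStage3Params` — [4] Thm 3.1-type letters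
(`SLet ∕ SLetUB`) at the `Ω₀ = ℤᵈ` LAW members and (`SLetL ∕ SLetLU`) at the Prop.-5 members `ι` (with their three member laws); N06's `h33 : B9.Thm33Printed c35 geo bg Gp GA` BY
NAME; dag-n06-b's member-local operator dictionaries at the law members (`hdict hP6at hinv hcurv hlan havg hhol hlin hsrc hsrcH`) and in edition β at the cube members
(`hdictC hP6C hinvC hcurvC hlanC havgC`); Proposition 5's three plain sockets at the cube members for every `B₀ˢ ≥ 1` (`hSP5C`); a consumer threshold `B₁⁰`; N05's printed
member `p7` (Prop. 7 p. 100 for `lam₀`'s axial map) — give, for every window `γw ∈ ]0, θ.γ]`, [B9] inputs and constants `inp C₂ B₁′ B₁ B₂ B₀β c₁` (`0 < c₁`, `B₁⁰ ≤ B₁`)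
and worlds `w w′`: `IsRecordOfRecord₁₃CSepCoPHSX3HV F N (datumOfRecord₁₃SepCoPH θ h) w` (and the same `w` in dag-n10-d's S-class `IsRecordOfRecord₁₃CSepCoPHS`) with its
binding DISPLAYED at the cut layer
`(θ.pinX3H ({lam₀ with inp, C₂, B₁′, B₁, B₂, B₀β}.cutSubB J (zdLan θ.L B₁ ∘ ι) c₁) lam12 lam13).view₁₃CoPHB10YZW Mstar opsY ζ lamW`, EVERY run's `b8` leaf and `Dag.B8_main (leavesP w P)`,
and the same-datum companion `IsRecordOfRecord₁₃CSepCoPH … w′`.  NOT a discharge of N05: the dictionaries, the letters, the cube-member Prop.-5 sockets, `Prop6At`, `p7` are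
hypotheses.
[cite: Balaban1985RegularSpaces, Lemma 1 p.79, Thm 2 p.83, Prop. 3 p.87, Thm 4 p.88, Prop. 5 p.94, Thm 8 (1.146) p.101, Prop. 6 pp.98–99 (supplied modulo hypotheses); Prop. 7 p.100 (named hypothesis); Balaban1985BackgroundPropagators, Thm 3.3 p.399 (by name), Thm 3.1 p.397 (hypotheses); Balaban1989LargeFieldII, Thm 1 + (0.1) pp.355–356 (the record, bookkeeping)] -/
theorem exists_isRecordOfRecord₁₃CSepCoPHSX3HV_b8_of_thm33_lettersRDU_univ_lin_p6β (θ : Stage13HParams F N) (h : θ.Provisos₁₃SepCoPH F N) (hθ : θ.Admissible F N)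
    (lam12 : ResidB12 F N θ.τ9.M) (lam13 : B12.RunParams → ResidB13 θ.toStage3Params) (Mstar : ℕ) (opsY : OpsY N θ.toStage3Params Mstar)
    (ζ : ResidZ F N) (lamW : ResidW F N) (hD : 2 ≤ θ.toStage3Params.D) (lam₀ : ResidB8 θ.toStage3Params)
    -- [4] THM 3.1-TYPE LETTERS at the `Ω₀ = ℤᵈ` LAW MEMBERS (existence side on print's domains; uniqueness side) — hypotheses, as in p521275
    {B₀'H B₂' BG BR cL : ℝ} (hB₀'H : 0 < B₀'H) (hB₂' : 0 ≤ B₂') (hBG : 0 ≤ BG) (hBR : 0 ≤ BR) (hcL : 0 < cL)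
    (SLet : ∀ i : ZdIdx θ.toStage3Params.D θ.toStage3Params.L, i.Ω 0 = Set.univ → IdxB8LawsB θ.toStage3Params.L i → SockLettersRD (𝔸 := θ.toStage3Params.𝔸) θ.toStage3Params.L BG BR B₀'H B₂' cL i.η i.k i.Ω i.Λs)
    (SLetUB : ∀ i : ZdIdx θ.toStage3Params.D θ.toStage3Params.L, i.Ω 0 = Set.univ → IdxB8LawsB θ.toStage3Params.L i → ∀ α₀ : ℝ, 0 < α₀ → α₀ ≤ cL → ∀ U₀ : Site θ.toStage3Params.D → Fin θ.toStage3Params.D → θ.toStage3Params.𝔸ˣ, (∀ x κ, U₀ x κ ∈ unitaryUnits θ.toStage3Params.𝔸) →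
      InAk θ.toStage3Params.L i.k i.η α₀ i.Ω U₀ →
      ∃ (g Δ : (Site θ.toStage3Params.D → θ.toStage3Params.𝔸) →ₗ[ℂ] (Site θ.toStage3Params.D → θ.toStage3Params.𝔸)) (q : (Site θ.toStage3Params.D → θ.toStage3Params.𝔸) →ₗ[ℂ] (ℕ → Site θ.toStage3Params.D → θ.toStage3Params.𝔸))
        (qs : (ℕ → Site θ.toStage3Params.D → θ.toStage3Params.𝔸) →ₗ[ℂ] (Site θ.toStage3Params.D → θ.toStage3Params.𝔸)) (Aw c : (ℕ → Site θ.toStage3Params.D → θ.toStage3Params.𝔸) →ₗ[ℂ] (ℕ → Site θ.toStage3Params.D → θ.toStage3Params.𝔸))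
        (H' : XSpace θ.toStage3Params.D i.k θ.toStage3Params.𝔸 →ₗ[ℂ] (Site θ.toStage3Params.D → θ.toStage3Params.𝔸)),
        (∀ x : Site θ.toStage3Params.D → θ.toStage3Params.𝔸, (∃ C : ℝ, ∀ y, ‖x y‖ ≤ C) → g (Δ x + qs (Aw (q x))) = x) ∧ (∀ φ, qs (c (q (g (g (qs φ))))) = qs φ) ∧
        (∀ (f : Site θ.toStage3Params.D → θ.toStage3Params.𝔸), ∀ x ∈ i.Ω 0, Δ f x = covLap i.η U₀ ((i.Ω 0).indicator f) x) ∧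
        (∀ (μ : ℕ → Site θ.toStage3Params.D → θ.toStage3Params.𝔸), ∀ x ∈ i.Ω 0, qs μ x = QT θ.toStage3Params.L i.k (i.Λs i.k) U₀ μ x) ∧
        (∀ (f : Site θ.toStage3Params.D → θ.toStage3Params.𝔸) (n : ℕ), n ≤ i.k → ∀ y ∈ i.Λs i.k n, q f n y = QprimeIter (zdBlocking θ.toStage3Params.D θ.toStage3Params.L) (bgT θ.toStage3Params.L U₀) n f y) ∧
        (∀ (f : Site θ.toStage3Params.D → θ.toStage3Params.𝔸) (n : ℕ) (y : Site θ.toStage3Params.D), ¬ (n ≤ i.k ∧ y ∈ i.Λs i.k n) → q f n y = 0) ∧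
        (∀ (X : XSpace θ.toStage3Params.D i.k θ.toStage3Params.𝔸) (x : Site θ.toStage3Params.D), ‖H' X x‖ ≤ B₀'H * ‖X‖) ∧
        (∀ n, n ≤ i.k → ∀ (X : XSpace θ.toStage3Params.D i.k θ.toStage3Params.𝔸), ∀ p ∈ {b : Site θ.toStage3Params.D × Fin θ.toStage3Params.D | SideTouches (i.Ω n) b.1 b.2},
          wt θ.toStage3Params.L i.η n * ‖covDerivFwd i.η U₀ p.2 (H' X) p.1‖ ≤ B₀'H * ‖X‖) ∧
        (∀ X : XSpace θ.toStage3Params.D i.k θ.toStage3Params.𝔸, Bd2 θ.toStage3Params.L i.η i.k i.Ω (covLap i.η U₀ (H' X)) (B₂' * ‖X‖)) ∧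
        (∀ (Y : XSpace θ.toStage3Params.D i.k θ.toStage3Params.𝔸) (n : ℕ) (hn : n ≤ i.k) (y : Site θ.toStage3Params.D), y ∈ i.Λs i.k n →
          QprimeIter (zdBlocking θ.toStage3Params.D θ.toStage3Params.L) (bgT θ.toStage3Params.L U₀) n (H' Y) y = Y (⟨n, Nat.lt_succ_of_le hn⟩, y)) ∧
        (∀ (f : Site θ.toStage3Params.D → θ.toStage3Params.𝔸) (r : ℝ), 0 ≤ r → Bd2 θ.toStage3Params.L i.η i.k i.Ω f r →
          (∀ x, ‖g f x‖ ≤ BG * r) ∧ ∀ n, n ≤ i.k → ∀ p ∈ {b : Site θ.toStage3Params.D × Fin θ.toStage3Params.D | SideTouches (i.Ω n) b.1 b.2},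
            wt θ.toStage3Params.L i.η n * ‖covDerivFwd i.η U₀ p.2 (g f) p.1‖ ≤ BG * r) ∧
        (∀ (f : Site θ.toStage3Params.D → θ.toStage3Params.𝔸) (r : ℝ), 0 ≤ r → Bd2 θ.toStage3Params.L i.η i.k i.Ω f r → Bd2 θ.toStage3Params.L i.η i.k i.Ω (f - g (qs (c (q (g f))))) (BR * r)))
    -- PROPOSITION 5's INDEX READ AS OBJECTS: `zdLan` members obeying the member laws, with [4]'s letters at each (RD currency), as in p521275
    {J : Type} (ι : J → ZdLanIdx θ.toStage3Params.D θ.toStage3Params.𝔸)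
    (hΩ0L : ∀ a : J, (ι a).Ω 0 = Set.univ) (hΩL : ∀ a : J, ∀ j, (ι a).Ω (j + 1) ⊆ (ι a).Ω j)
    (htowerL : ∀ a : J, ∀ j, j ≤ (ι a).k → ∀ y ∈ (ι a).Λ j, ∀ x, InBox (tlo θ.toStage3Params.L y j) (thi θ.toStage3Params.L y j) x → x ∈ (ι a).Ω j)
    (SLetL : ∀ a : J, ∀ α₀ : ℝ, 0 < α₀ → α₀ ≤ cL → InAk θ.toStage3Params.L (ι a).k (ι a).η α₀ (ι a).Ω (ι a).U₀ →
      ∃ (g Δ : (Site θ.toStage3Params.D → θ.toStage3Params.𝔸) →ₗ[ℂ] (Site θ.toStage3Params.D → θ.toStage3Params.𝔸)) (q : (Site θ.toStage3Params.D → θ.toStage3Params.𝔸) →ₗ[ℂ] (ℕ → Site θ.toStage3Params.D → θ.toStage3Params.𝔸))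
        (qs : (ℕ → Site θ.toStage3Params.D → θ.toStage3Params.𝔸) →ₗ[ℂ] (Site θ.toStage3Params.D → θ.toStage3Params.𝔸)) (Aw c : (ℕ → Site θ.toStage3Params.D → θ.toStage3Params.𝔸) →ₗ[ℂ] (ℕ → Site θ.toStage3Params.D → θ.toStage3Params.𝔸))
        (H' : XSpace θ.toStage3Params.D (ι a).k θ.toStage3Params.𝔸 →ₗ[ℂ] (Site θ.toStage3Params.D → θ.toStage3Params.𝔸)),
        (∀ x, ∀ y ∈ (ι a).Ω 0, (Δ (g x) + qs (Aw (q (g x)))) y = x y) ∧ (∀ f, q (g (g (qs (c (q f))))) = q f) ∧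
        (∀ (f : Site θ.toStage3Params.D → θ.toStage3Params.𝔸), ∀ x ∈ (ι a).Ω 0, Δ f x = covLap (ι a).η (ι a).U₀ (((ι a).Ω 0).indicator f) x) ∧
        (∀ (μ : ℕ → Site θ.toStage3Params.D → θ.toStage3Params.𝔸), ∀ x ∈ (ι a).Ω 0, qs μ x = QT θ.toStage3Params.L (ι a).k (ι a).Λ (ι a).U₀ μ x) ∧
        (∀ (f : Site θ.toStage3Params.D → θ.toStage3Params.𝔸) (j : ℕ), j ≤ (ι a).k → ∀ y ∈ (ι a).Λ j, q f j y = QprimeIter (zdBlocking θ.toStage3Params.D θ.toStage3Params.L) (bgT θ.toStage3Params.L (ι a).U₀) j f y) ∧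
        (∀ (X : XSpace θ.toStage3Params.D (ι a).k θ.toStage3Params.𝔸) (x : Site θ.toStage3Params.D), ‖H' X x‖ ≤ B₀'H * ‖X‖) ∧
        (∀ j, j ≤ (ι a).k → ∀ (X : XSpace θ.toStage3Params.D (ι a).k θ.toStage3Params.𝔸), ∀ p ∈ {b : Site θ.toStage3Params.D × Fin θ.toStage3Params.D | SideTouches ((ι a).Ω j) b.1 b.2},
          wt θ.toStage3Params.L (ι a).η j * ‖covDerivFwd (ι a).η (ι a).U₀ p.2 (H' X) p.1‖ ≤ B₀'H * ‖X‖) ∧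
        (∀ X : XSpace θ.toStage3Params.D (ι a).k θ.toStage3Params.𝔸, Bd2 θ.toStage3Params.L (ι a).η (ι a).k (ι a).Ω (covLap (ι a).η (ι a).U₀ (H' X)) (B₂' * ‖X‖)) ∧
        (∀ (X : XSpace θ.toStage3Params.D (ι a).k θ.toStage3Params.𝔸) (x : Site θ.toStage3Params.D), x ∉ (ι a).Ω 0 → H' X x = 0) ∧
        (∀ X Y : XSpace θ.toStage3Params.D (ι a).k θ.toStage3Params.𝔸, (∀ p, Y p = -star (X p)) → ∀ x, H' Y x = -star (H' X x)) ∧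
        (∀ (Y : XSpace θ.toStage3Params.D (ι a).k θ.toStage3Params.𝔸) (j : ℕ) (hj : j ≤ (ι a).k) (y : Site θ.toStage3Params.D), y ∈ (ι a).Λ j →
          QprimeIter (zdBlocking θ.toStage3Params.D θ.toStage3Params.L) (bgT θ.toStage3Params.L (ι a).U₀) j (H' Y) y = Y (⟨j, Nat.lt_succ_of_le hj⟩, y)) ∧
        (∀ (f : Site θ.toStage3Params.D → θ.toStage3Params.𝔸) (r : ℝ), 0 ≤ r → Bd2 θ.toStage3Params.L (ι a).η (ι a).k (ι a).Ω f r →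
          (∀ x, ‖g f x‖ ≤ BG * r) ∧ ∀ j, j ≤ (ι a).k → ∀ p ∈ {b : Site θ.toStage3Params.D × Fin θ.toStage3Params.D | SideTouches ((ι a).Ω j) b.1 b.2},
            wt θ.toStage3Params.L (ι a).η j * ‖covDerivFwd (ι a).η (ι a).U₀ p.2 (g f) p.1‖ ≤ BG * r) ∧
        (∀ (f : Site θ.toStage3Params.D → θ.toStage3Params.𝔸) (x : Site θ.toStage3Params.D), x ∉ (ι a).Ω 0 → g f x = 0) ∧
        (∀ f : Site θ.toStage3Params.D → θ.toStage3Params.𝔸, (∀ j, j ≤ (ι a).k → ∀ x ∈ (ι a).Ω j, IsSelfAdjoint (f x)) → ∀ x, IsSelfAdjoint (g f x)) ∧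
        (∀ (f : Site θ.toStage3Params.D → θ.toStage3Params.𝔸) (r : ℝ), 0 ≤ r → Bd2 θ.toStage3Params.L (ι a).η (ι a).k (ι a).Ω f r →
          Bd2 θ.toStage3Params.L (ι a).η (ι a).k (ι a).Ω (f - g (qs (c (q (g f))))) (BR * r)) ∧
        (∀ f : Site θ.toStage3Params.D → θ.toStage3Params.𝔸, (∀ j, j ≤ (ι a).k → ∀ x ∈ (ι a).Ω j, IsSelfAdjoint (f x)) →
          ∀ j, j ≤ (ι a).k → ∀ x ∈ (ι a).Ω j, IsSelfAdjoint ((f - g (qs (c (q (g f))))) x)))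
    (SLetLU : ∀ a : J, ∀ α₀ : ℝ, 0 < α₀ → α₀ ≤ cL → InAk θ.toStage3Params.L (ι a).k (ι a).η α₀ (ι a).Ω (ι a).U₀ →
      ∃ (g Δ : (Site θ.toStage3Params.D → θ.toStage3Params.𝔸) →ₗ[ℂ] (Site θ.toStage3Params.D → θ.toStage3Params.𝔸)) (q : (Site θ.toStage3Params.D → θ.toStage3Params.𝔸) →ₗ[ℂ] (ℕ → Site θ.toStage3Params.D → θ.toStage3Params.𝔸)) (qs : (ℕ → Site θ.toStage3Params.D → θ.toStage3Params.𝔸) →ₗ[ℂ] (Site θ.toStage3Params.D → θ.toStage3Params.𝔸))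
        (Aw c : (ℕ → Site θ.toStage3Params.D → θ.toStage3Params.𝔸) →ₗ[ℂ] (ℕ → Site θ.toStage3Params.D → θ.toStage3Params.𝔸)) (H' : XSpace θ.toStage3Params.D (ι a).k θ.toStage3Params.𝔸 →ₗ[ℂ] (Site θ.toStage3Params.D → θ.toStage3Params.𝔸)),
        (∀ x : Site θ.toStage3Params.D → θ.toStage3Params.𝔸, (∃ C : ℝ, ∀ y, ‖x y‖ ≤ C) → g (Δ x + qs (Aw (q x))) = x) ∧ (∀ φ, qs (c (q (g (g (qs φ))))) = qs φ) ∧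
        (∀ (f : Site θ.toStage3Params.D → θ.toStage3Params.𝔸), ∀ x ∈ (ι a).Ω 0, Δ f x = covLap (ι a).η (ι a).U₀ (((ι a).Ω 0).indicator f) x) ∧
        (∀ (μ : ℕ → Site θ.toStage3Params.D → θ.toStage3Params.𝔸), ∀ x ∈ (ι a).Ω 0, qs μ x = QT θ.toStage3Params.L (ι a).k (ι a).Λ (ι a).U₀ μ x) ∧
        (∀ (f : Site θ.toStage3Params.D → θ.toStage3Params.𝔸) (n : ℕ), n ≤ (ι a).k → ∀ y ∈ (ι a).Λ n, q f n y = QprimeIter (zdBlocking θ.toStage3Params.D θ.toStage3Params.L) (bgT θ.toStage3Params.L (ι a).U₀) n f y) ∧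
        (∀ (f : Site θ.toStage3Params.D → θ.toStage3Params.𝔸) (n : ℕ) (y : Site θ.toStage3Params.D), ¬ (n ≤ (ι a).k ∧ y ∈ (ι a).Λ n) → q f n y = 0) ∧
        (∀ (X : XSpace θ.toStage3Params.D (ι a).k θ.toStage3Params.𝔸) (x : Site θ.toStage3Params.D), ‖H' X x‖ ≤ B₀'H * ‖X‖) ∧
        (∀ n, n ≤ (ι a).k → ∀ (X : XSpace θ.toStage3Params.D (ι a).k θ.toStage3Params.𝔸), ∀ p ∈ {b : Site θ.toStage3Params.D × Fin θ.toStage3Params.D | SideTouches ((ι a).Ω n) b.1 b.2},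
          wt θ.toStage3Params.L (ι a).η n * ‖covDerivFwd (ι a).η (ι a).U₀ p.2 (H' X) p.1‖ ≤ B₀'H * ‖X‖) ∧
        (∀ X : XSpace θ.toStage3Params.D (ι a).k θ.toStage3Params.𝔸, Bd2 θ.toStage3Params.L (ι a).η (ι a).k (ι a).Ω (covLap (ι a).η (ι a).U₀ (H' X)) (B₂' * ‖X‖)) ∧
        (∀ (Y : XSpace θ.toStage3Params.D (ι a).k θ.toStage3Params.𝔸) (n : ℕ) (hn : n ≤ (ι a).k) (y : Site θ.toStage3Params.D), y ∈ (ι a).Λ n →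
          QprimeIter (zdBlocking θ.toStage3Params.D θ.toStage3Params.L) (bgT θ.toStage3Params.L (ι a).U₀) n (H' Y) y = Y (⟨n, Nat.lt_succ_of_le hn⟩, y)) ∧
        (∀ (f : Site θ.toStage3Params.D → θ.toStage3Params.𝔸) (r : ℝ), 0 ≤ r → Bd2 θ.toStage3Params.L (ι a).η (ι a).k (ι a).Ω f r →
          (∀ x, ‖g f x‖ ≤ BG * r) ∧ ∀ n, n ≤ (ι a).k → ∀ p ∈ {b : Site θ.toStage3Params.D × Fin θ.toStage3Params.D | SideTouches ((ι a).Ω n) b.1 b.2},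
            wt θ.toStage3Params.L (ι a).η n * ‖covDerivFwd (ι a).η (ι a).U₀ p.2 (g f) p.1‖ ≤ BG * r) ∧
        (∀ (f : Site θ.toStage3Params.D → θ.toStage3Params.𝔸) (r : ℝ), 0 ≤ r → Bd2 θ.toStage3Params.L (ι a).η (ι a).k (ι a).Ω f r →
          Bd2 θ.toStage3Params.L (ι a).η (ι a).k (ι a).Ω (f - g (qs (c (q (g f))))) (BR * r)))
    -- N06 BY NAME: [Balaban1985BackgroundPropagators] THEOREM 3.3 as typed by the N06 lineage (the `t33` conjunct of the [B9] leaf), for an abstract indexed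
    -- geometry ∕ background ∕ kernel family, and dag-n06-b's member-local OPERATOR DICTIONARY at the `Ω₀ = ℤᵈ` LAW MEMBERS (object layer: the index map `mem`,
    -- configuration ∕ location transports `ιCfg ∕ ιLoc`, operator letters `ops`) — hypotheses; `Prop6At` is [Balaban1985RegularSpaces] Prop. 6 (1.136) in
    -- [4]'s dress (3.35), N05-OWN content displayed
    {I : Type} (geo : I → B9.Geometry) (bg : I → B9.Backgrounds) (GA : ∀ i, B9.KernelFamily (geo i) (bg i)) {Gp : ∀ i, B9.KernelFamily (geo i) (bg i)}
    (mem : ℝ → ZdIdx θ.toStage3Params.D θ.toStage3Params.L → ℕ → I)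
    (ιCfg : ∀ (M : ℝ) (i : ZdIdx θ.toStage3Params.D θ.toStage3Params.L) (m : ℕ) (U₀ : Site θ.toStage3Params.D → Fin θ.toStage3Params.D → θ.toStage3Params.𝔸ˣ), (∀ x κ, U₀ x κ ∈ unitaryUnits θ.toStage3Params.𝔸) → (bg (mem M i m)).Cfg)
    (ιLoc : ∀ (M : ℝ) (i : ZdIdx θ.toStage3Params.D θ.toStage3Params.L) (m : ℕ), (Site θ.toStage3Params.D → Fin θ.toStage3Params.D → θ.toStage3Params.𝔸) → (geo (mem M i m)).Loc)
    (ops : ℝ → ZdIdx θ.toStage3Params.D θ.toStage3Params.L → ℕ → OpsZd θ.toStage3Params.D θ.toStage3Params.𝔸)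
    {c35 c₆ K₆ M₃ a₃ c69 q CH cS cSβ : ℝ} (h33 : B9.Thm33Printed c35 geo bg Gp GA)
    (hdict : ∀ (M : ℝ) (i : ZdIdx θ.toStage3Params.D θ.toStage3Params.L), i.Ω 0 = Set.univ → IdxB8LawsB θ.toStage3Params.L i → ∀ m : ℕ, DictAt geo bg GA θ.toStage3Params.L mem ιCfg ιLoc ops M i m)
    (hP6at : ∀ (M : ℝ) (i : ZdIdx θ.toStage3Params.D θ.toStage3Params.L), i.Ω 0 = Set.univ → IdxB8LawsB θ.toStage3Params.L i → ∀ m : ℕ, M₃ ≤ M → Prop6At bg θ.toStage3Params.L mem ιCfg c35 c₆ K₆ M i m)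
    (hinv : ∀ (M : ℝ) (i : ZdIdx θ.toStage3Params.D θ.toStage3Params.L), i.Ω 0 = Set.univ → IdxB8LawsB θ.toStage3Params.L i → ∀ m : ℕ, M₃ ≤ M → InvAt bg θ.toStage3Params.L mem ιCfg ops c35 a₃ M i m)
    (hcurv : ∀ (M : ℝ) (i : ZdIdx θ.toStage3Params.D θ.toStage3Params.L), i.Ω 0 = Set.univ → IdxB8LawsB θ.toStage3Params.L i → ∀ m : ℕ, M₃ ≤ M → CurvAt bg θ.toStage3Params.L mem ιCfg ops c35 a₃ c69 M i m)
    (hlan : ∀ (M : ℝ) (i : ZdIdx θ.toStage3Params.D θ.toStage3Params.L), i.Ω 0 = Set.univ → IdxB8LawsB θ.toStage3Params.L i → ∀ m : ℕ, M₃ ≤ M → LandauAt bg θ.toStage3Params.L mem ιCfg ops c35 a₃ M i m)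
    (havg : ∀ (M : ℝ) (i : ZdIdx θ.toStage3Params.D θ.toStage3Params.L), i.Ω 0 = Set.univ → IdxB8LawsB θ.toStage3Params.L i → ∀ m : ℕ, AvgAt θ.toStage3Params.L ops q M i m)
    (hhol : ∀ (M : ℝ) (i : ZdIdx θ.toStage3Params.D θ.toStage3Params.L), i.Ω 0 = Set.univ → IdxB8LawsB θ.toStage3Params.L i → ∀ m : ℕ, HolderAt geo bg GA θ.toStage3Params.L mem ιCfg ops lam₀.β lam₀.len CH M i m)
    (hlin : ∀ (M : ℝ) (i : ZdIdx θ.toStage3Params.D θ.toStage3Params.L), i.Ω 0 = Set.univ → IdxB8LawsB θ.toStage3Params.L i → ∀ m : ℕ, LinBddAt θ.toStage3Params.L ops M i m)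
    (hsrc : ∀ (M : ℝ) (i : ZdIdx θ.toStage3Params.D θ.toStage3Params.L), i.Ω 0 = Set.univ → IdxB8LawsB θ.toStage3Params.L i → ∀ m : ℕ, M₃ ≤ M → SrcAt bg θ.toStage3Params.L mem ιCfg ops c35 a₃ cS M i m)
    (hsrcH : ∀ (M : ℝ) (i : ZdIdx θ.toStage3Params.D θ.toStage3Params.L), i.Ω 0 = Set.univ → IdxB8LawsB θ.toStage3Params.L i → ∀ m : ℕ, M₃ ≤ M →
      SrcHolderAt bg θ.toStage3Params.L mem ιCfg ops c35 a₃ lam₀.β lam₀.len cSβ M i m)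
    (hc₆ : 0 < c₆) (hK₆ : 0 < K₆) (ha₃ : 0 < a₃) (hc69 : 0 ≤ c69) (hq : 0 ≤ q) (hcS : 0 ≤ cS) (hcSβ : 0 ≤ cSβ)
    -- dag-n06-b's member-local dictionary IN EDITION β AT THE CUBE SUB-FAMILY of (1.131) (the SAME `mem ιCfg ιLoc ops` and constants; `AvgAtβ` — the (3.16)∕(1.56)
    -- averaging letter whose datum `|B₁|β` carries the level-0 crossing bonds) — hypotheses, read with `h33` by dag-n05-e's uniform `p6` letter
    (hdictC : ∀ (M : ℝ) (j : {i : ZdIdx θ.toStage3Params.D θ.toStage3Params.L // ∃ (a : Site θ.toStage3Params.D) (M ρ : ℕ), θ.toStage3Params.L ≤ ρ ∧ ρ ≤ M ∧ 11 * θ.toStage3Params.D < M ∧ θ.toStage3Params.L ≤ θ.toStage3Params.D * M ∧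
          i.Ω = cubeFam false θ.toStage3Params.L a M ρ i.k ∧ i.Λs = cubeLamS θ.toStage3Params.L a M ρ i.k ∧ i.Λb = cubeLamB θ.toStage3Params.L a M ρ i.k}) (m : ℕ),
      DictAt geo bg GA θ.toStage3Params.L mem ιCfg ιLoc ops M j.1 m)
    (hP6C : ∀ (M : ℝ) (j : {i : ZdIdx θ.toStage3Params.D θ.toStage3Params.L // ∃ (a : Site θ.toStage3Params.D) (M ρ : ℕ), θ.toStage3Params.L ≤ ρ ∧ ρ ≤ M ∧ 11 * θ.toStage3Params.D < M ∧ θ.toStage3Params.L ≤ θ.toStage3Params.D * M ∧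
          i.Ω = cubeFam false θ.toStage3Params.L a M ρ i.k ∧ i.Λs = cubeLamS θ.toStage3Params.L a M ρ i.k ∧ i.Λb = cubeLamB θ.toStage3Params.L a M ρ i.k}) (m : ℕ),
      M₃ ≤ M → Prop6At bg θ.toStage3Params.L mem ιCfg c35 c₆ K₆ M j.1 m)
    (hinvC : ∀ (M : ℝ) (j : {i : ZdIdx θ.toStage3Params.D θ.toStage3Params.L // ∃ (a : Site θ.toStage3Params.D) (M ρ : ℕ), θ.toStage3Params.L ≤ ρ ∧ ρ ≤ M ∧ 11 * θ.toStage3Params.D < M ∧ θ.toStage3Params.L ≤ θ.toStage3Params.D * M ∧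
          i.Ω = cubeFam false θ.toStage3Params.L a M ρ i.k ∧ i.Λs = cubeLamS θ.toStage3Params.L a M ρ i.k ∧ i.Λb = cubeLamB θ.toStage3Params.L a M ρ i.k}) (m : ℕ),
      M₃ ≤ M → InvAt bg θ.toStage3Params.L mem ιCfg ops c35 a₃ M j.1 m)
    (hcurvC : ∀ (M : ℝ) (j : {i : ZdIdx θ.toStage3Params.D θ.toStage3Params.L // ∃ (a : Site θ.toStage3Params.D) (M ρ : ℕ), θ.toStage3Params.L ≤ ρ ∧ ρ ≤ M ∧ 11 * θ.toStage3Params.D < M ∧ θ.toStage3Params.L ≤ θ.toStage3Params.D * M ∧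
          i.Ω = cubeFam false θ.toStage3Params.L a M ρ i.k ∧ i.Λs = cubeLamS θ.toStage3Params.L a M ρ i.k ∧ i.Λb = cubeLamB θ.toStage3Params.L a M ρ i.k}) (m : ℕ),
      M₃ ≤ M → CurvAt bg θ.toStage3Params.L mem ιCfg ops c35 a₃ c69 M j.1 m)
    (hlanC : ∀ (M : ℝ) (j : {i : ZdIdx θ.toStage3Params.D θ.toStage3Params.L // ∃ (a : Site θ.toStage3Params.D) (M ρ : ℕ), θ.toStage3Params.L ≤ ρ ∧ ρ ≤ M ∧ 11 * θ.toStage3Params.D < M ∧ θ.toStage3Params.L ≤ θ.toStage3Params.D * M ∧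
          i.Ω = cubeFam false θ.toStage3Params.L a M ρ i.k ∧ i.Λs = cubeLamS θ.toStage3Params.L a M ρ i.k ∧ i.Λb = cubeLamB θ.toStage3Params.L a M ρ i.k}) (m : ℕ),
      M₃ ≤ M → LandauAt bg θ.toStage3Params.L mem ιCfg ops c35 a₃ M j.1 m)
    (havgC : ∀ (M : ℝ) (j : {i : ZdIdx θ.toStage3Params.D θ.toStage3Params.L // ∃ (a : Site θ.toStage3Params.D) (M ρ : ℕ), θ.toStage3Params.L ≤ ρ ∧ ρ ≤ M ∧ 11 * θ.toStage3Params.D < M ∧ θ.toStage3Params.L ≤ θ.toStage3Params.D * M ∧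
          i.Ω = cubeFam false θ.toStage3Params.L a M ρ i.k ∧ i.Λs = cubeLamS θ.toStage3Params.L a M ρ i.k ∧ i.Λb = cubeLamB θ.toStage3Params.L a M ρ i.k}) (m : ℕ),
      AvgAtβ θ.toStage3Params.L ops q M j.1 m)
    -- PROPOSITION 5's THREE PLAIN SOCKETS AT THE CUBE SUB-FAMILY for EVERY input constant `B₀ˢ ≥ 1`, at thresholds `B₀′ᶜ, c_u, c_P` chosen AFTER the constant
    -- (the servable quantifier shape, `P6-PLUG-T3.md` item 1) — hypotheses (N05's Prop.-5 lane at the cube members; `SockP5u` there has no in-tree provider)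
    (hSP5C : ∀ B₀S : ℝ, 1 ≤ B₀S → ∃ B₀'c cu cP : ℝ, 0 < B₀'c ∧ 0 < cu ∧ 0 < cP ∧
      (∀ i : {i : ZdIdx θ.toStage3Params.D θ.toStage3Params.L // ∃ (a : Site θ.toStage3Params.D) (M ρ : ℕ), θ.toStage3Params.L ≤ ρ ∧ ρ ≤ M ∧ 11 * θ.toStage3Params.D < M ∧ θ.toStage3Params.L ≤ θ.toStage3Params.D * M ∧
          i.Ω = cubeFam false θ.toStage3Params.L a M ρ i.k ∧ i.Λs = cubeLamS θ.toStage3Params.L a M ρ i.k ∧ i.Λb = cubeLamB θ.toStage3Params.L a M ρ i.k},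
          SockP5base (𝔸 := θ.toStage3Params.𝔸) θ.toStage3Params.L B₀S B₀'c cP i.1.η i.1.k i.1.Ω i.1.Λs) ∧
      (∀ i : {i : ZdIdx θ.toStage3Params.D θ.toStage3Params.L // ∃ (a : Site θ.toStage3Params.D) (M ρ : ℕ), θ.toStage3Params.L ≤ ρ ∧ ρ ≤ M ∧ 11 * θ.toStage3Params.D < M ∧ θ.toStage3Params.L ≤ θ.toStage3Params.D * M ∧
          i.Ω = cubeFam false θ.toStage3Params.L a M ρ i.k ∧ i.Λs = cubeLamS θ.toStage3Params.L a M ρ i.k ∧ i.Λb = cubeLamB θ.toStage3Params.L a M ρ i.k},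
          SockP5 (𝔸 := θ.toStage3Params.𝔸) θ.toStage3Params.L B₀S B₀'c cP i.1.η i.1.k i.1.Ω i.1.Λs) ∧
      (∀ i : {i : ZdIdx θ.toStage3Params.D θ.toStage3Params.L // ∃ (a : Site θ.toStage3Params.D) (M ρ : ℕ), θ.toStage3Params.L ≤ ρ ∧ ρ ≤ M ∧ 11 * θ.toStage3Params.D < M ∧ θ.toStage3Params.L ≤ θ.toStage3Params.D * M ∧
          i.Ω = cubeFam false θ.toStage3Params.L a M ρ i.k ∧ i.Λs = cubeLamS θ.toStage3Params.L a M ρ i.k ∧ i.Λb = cubeLamB θ.toStage3Params.L a M ρ i.k},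
          SockP5u (𝔸 := θ.toStage3Params.𝔸) θ.toStage3Params.L cP cu i.1.η i.1.k i.1.Ω i.1.Λs))
    -- the consumer's Proposition-6 threshold `B₁⁰` (kept: the produced `B₁ ≥ B₁⁰`) and N05's printed Proposition 7 for `lam₀`'s axial map (displayed hypothesis)
    (B₁₀ : ℝ)
    (p7 : B8SectGH.Prop7PrintedR (fun j : IdxB8SubB θ.toStage3Params => famB8OfRecordSubB θ.toStage3Params lam₀.β lam₀.len j) (fun j => lam₀.toAxial j.1))
    {γw : ℝ} (hγ0 : 0 < γw) (hγ1 : γw ≤ θ.γ) :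
    ∃ (inp : B8.B9Inputs) (C₂ B₁' B₁ B₂ B₀β c₁ : ℝ), 0 < c₁ ∧ B₁₀ ≤ B₁ ∧
    ∃ w w' : WorldP, IsRecordOfRecord₁₃CSepCoPHSX3HV F N (datumOfRecord₁₃SepCoPH F N θ h) w ∧
      IsRecordOfRecord₁₃CSepCoPHS F N (datumOfRecord₁₃SepCoPH F N θ h) w ∧
      w.C = (datumOfRecord₁₃SepCoPH F N θ h).C ∧ w.γ = γw ∧ w.L = (θ.L : ℝ) ∧
      (∀ P : B12.RunParams, w.up P =
        upOfRecord₅CS F N ((θ.pinX3H F N ((({ lam₀ with inp := inp, C₂ := C₂, B₁' := B₁', B₁ := B₁, B₂ := B₂, B₀β := B₀β } : ResidB8 θ.toStage3Params).cutSubB J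
          (fun a : J => zdLan θ.toStage3Params.L B₁ (ι a)) c₁)) lam12 lam13).view₁₃CoPHB10YZW F N Mstar opsY ζ lamW) P) ∧
      (∀ P : B12.RunParams, (leavesP w P).b8 ∧ Dag.B8_main (leavesP w P)) ∧
      IsRecordOfRecord₁₃CSepCoPH F N (datumOfRecord₁₃SepCoPH F N θ h) w' ∧ w'.C = w.C ∧ w'.γ = w.γ ∧ w'.L = w.L ∧
      ∀ P : B12.RunParams, leavesP w P = { leavesP w' P with b8 := (leavesP w P).b8 } := by
  obtain ⟨inp, C₂, B₁', B₁, B₂, B₀β, c₁, hc₁, hB₁, hleaf⟩ := exists_b8LeafOfRecordSubBH_cutSubB_zdLan_of_thm33_lettersRDU_univ_lin_p6β hD lam₀ hB₀'H hB₂' hBG hBR hcL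
    SLet SLetUB ι hΩ0L hΩL htowerL SLetL SLetLU geo bg GA mem ιCfg ιLoc ops h33 hdict hP6at hinv hcurv hlan havg hhol hlin hsrc hsrcH hc₆ hK₆ ha₃ hc69 hq hcS hcSβ
    hdictC hP6C hinvC hcurvC hlanC havgC hSP5C B₁₀ p7
  obtain ⟨w, w', hrec, hC, hγ, hL, hup, hb8, hw', hC', hγ', hL', hleaves⟩ :=
    exists_isRecordOfRecord₁₃CSepCoPHSX3HV_b8_of_leaf θ h hθ _ lam12 lam13 Mstar opsY ζ lamW hleaf hγ0 hγ1
  exact ⟨inp, C₂, B₁', B₁, B₂, B₀β, c₁, hc₁, hB₁, w, w', hrec, isRecordOfRecord₁₃CSepCoPHS_of_isRecordOfRecord₁₃CSepCoPHSX3HV hrec, hC, hγ, hL, hup, hb8, hw', hC',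
    hγ', hL', hleaves⟩

end Record

#print axioms exists_isRecordOfRecord₁₃CSepCoPHSX3HV_b8_of_thm33_lettersRDU_univ_lin_p6β

end Summit.QuantumFields.YangMills.BalabanUVNodes.N05AtXPinnedHSViewSepCoPHOfThm33P6Beta

end
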